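import Mathlib
import Literature.Analysis.FluidPDE.GaussianVortexPlanar
import Literature.Analysis.FluidPDE.GaussianVortexPlanarProofs
import Literature.Analysis.FluidPDE.BiotSavart2DSymmetry
import HarnessLib

/-!
# Helper `biotSavart2D_mul_sq_integral_le` toward stub `stub_coreInverse` of the line `braid-closed-large-circulation-gluing`
# (crux stmt-AnomalousDissipation-3009, `MarginalStabilityChain.StretchedVortexRows`)

A Young-type weighted `L²` bound for the planar Biot–Savart law `v = K ∗ w`, `K(z) = z^⊥/(2π|z|²)`:

  `∫ ‖v‖² h² ≤ C (H² ∫ w² + ‖w‖₁² ∫ h²)`  for `|h| ≤ H`, `h ∈ L²`, `w ∈ C⁰ ∩ L¹ ∩ L²`.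

Proof. `‖K(z)‖ = (2π|z|)⁻¹ ≤ (2π)⁻¹ (k₁(z) + 1)` with the cut-off majorant `k₁ = 𝟙_{|z|<1}|z|⁻¹ ∈ L¹(ℝ²)`
(`I₁ := ∫ k₁`, tree `integrable_indicator_inv_norm`), so that for every `ξ`

  `‖v(ξ)‖ ≤ (2π)⁻¹ (a(ξ) + ‖w‖₁)`, `a(ξ) := ∫ |w(η)| k₁(ξ − η) dη`

(`a(ξ) < ∞` since the continuous `w` is bounded on the disc `|η − ξ| ≤ 1`). Cauchy–Schwarz against the
finite measure `k₁(ξ − η) dη` gives `a(ξ)² ≤ I₁ b(ξ)`, `b(ξ) := ∫ w(η)² k₁(ξ − η) dη = (w² ∗ k₁)(ξ)`, whence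

  `‖v(ξ)‖² ≤ 2 (2π)⁻² (I₁ b(ξ) + ‖w‖₁²)`,  `‖v(ξ)‖² h(ξ)² ≤ 2 (2π)⁻² (I₁ H² b(ξ) + ‖w‖₁² h(ξ)²)`.

The right-hand side is integrable with integral `2 (2π)⁻² (I₁² H² ∫ w² + ‖w‖₁² ∫ h²)` (Fubini and translation
invariance: `∫ b = I₁ ∫ w²`, Mathlib `integral_convolution`); this dominates `‖v‖² h²` (measurable: tree
`stronglyMeasurable_biotSavart2D`) and `C := 2 (2π)⁻² (I₁² + 1)` works. No Hardy–Littlewood–Sobolev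
inequality and no `L^∞` bound on `w` are used.

References: the kernel `K` is (1.3) of Th. Gallay, C. E. Wayne, J. Math. Fluid Mech. 9 (2007); the estimate is the
elementary `L¹ + L^∞` splitting of `|z|⁻¹` (Young's inequality), folklore.
-/

set_option linter.dupNamespace false

noncomputable section

open scoped RealInnerProductSpace Topology ContDiff
open MeasureTheory WithLp Function Metric Filter Set

namespace Summit.AnomalousDissipation.AnomalousDissipation.Theorems.MarginalStabilityChainStretchedVortexRows

open Literature.Analysis.FluidPDE

/-- `L¹ + L^∞` majorant of the Biot–Savart kernel: `‖K(z)‖ ≤ (2π)⁻¹ (𝟙_{|z|<1}|z|⁻¹ + 1)`. [folklore] -/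
theorem norm_biotSavartKernel2D_le_indicator_add_one (z : EuclideanSpace ℝ (Fin 2)) :
    ‖biotSavartKernel2D z‖ ≤
      (2 * Real.pi)⁻¹ * (indicator (ball (0 : EuclideanSpace ℝ (Fin 2)) 1) (fun z => ‖z‖⁻¹) z + 1) := by
  rw [norm_biotSavartKernel2D]
  refine mul_le_mul_of_nonneg_left ?_ (by positivity)
  by_cases hz : ‖z‖ < 1
  · rw [indicator_of_mem (mem_ball_zero_iff.2 hz)]
    linarith
  · rw [indicator_of_notMem (by rwa [mem_ball_zero_iff]), zero_add]
    exact inv_le_one_of_one_le₀ (not_lt.1 hz)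

/-- For continuous `φ`, `η ↦ φ(η) 𝟙_{|ξ−η|<1}|ξ−η|⁻¹` is integrable (`φ` is bounded on the closed unit disc
about `ξ`, and `|z|⁻¹ ∈ L¹(disc)`). [folklore] -/
theorem integrable_mul_indicator_inv_norm_of_continuous {φ : EuclideanSpace ℝ (Fin 2) → ℝ}
    (hφ : Continuous φ) (ξ : EuclideanSpace ℝ (Fin 2)) :
    Integrable fun η => φ η * indicator (ball (0 : EuclideanSpace ℝ (Fin 2)) 1) (fun z => ‖z‖⁻¹) (ξ - η) := by
  obtain ⟨C, hC⟩ := (isCompact_closedBall ξ 1).exists_bound_of_continuousOn hφ.continuousOn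
  have hki : Integrable fun η => indicator (ball (0 : EuclideanSpace ℝ (Fin 2)) 1) (fun z => ‖z‖⁻¹) (ξ - η) :=
    integrable_indicator_inv_norm.comp_sub_left ξ
  refine Integrable.mono' (hki.const_mul C) (hφ.aestronglyMeasurable.mul hki.aestronglyMeasurable)
    (Eventually.of_forall fun η => ?_)
  rw [norm_mul, Real.norm_of_nonneg (indicator_inv_norm_nonneg _)]
  by_cases hη : ξ - η ∈ ball (0 : EuclideanSpace ℝ (Fin 2)) 1
  · refine mul_le_mul_of_nonneg_right (hC η ?_) (indicator_inv_norm_nonneg _)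
    rw [mem_closedBall, dist_eq_norm, ← norm_neg, neg_sub]
    exact (mem_ball_zero_iff.1 hη).le
  · rw [indicator_of_notMem hη, mul_zero, mul_zero]

/-- **Cauchy–Schwarz against the weight `k₁(ξ − ·)`**, `k₁ = 𝟙_{|z|<1}|z|⁻¹`:
`(∫ |w(η)| k₁(ξ−η) dη)² ≤ (∫ k₁) ∫ w(η)² k₁(ξ−η) dη` for continuous `w`. [folklore] -/
theorem sq_integral_abs_mul_indicator_inv_norm_le {w : EuclideanSpace ℝ (Fin 2) → ℝ} (hw : Continuous w)
    (ξ : EuclideanSpace ℝ (Fin 2)) :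
    (∫ η, |w η| * indicator (ball (0 : EuclideanSpace ℝ (Fin 2)) 1) (fun z => ‖z‖⁻¹) (ξ - η)) ^ 2 ≤
      (∫ z, indicator (ball (0 : EuclideanSpace ℝ (Fin 2)) 1) (fun z => ‖z‖⁻¹) z) *
        ∫ η, w η ^ 2 * indicator (ball (0 : EuclideanSpace ℝ (Fin 2)) 1) (fun z => ‖z‖⁻¹) (ξ - η) := by
  set k : EuclideanSpace ℝ (Fin 2) → ℝ :=
    fun η => indicator (ball (0 : EuclideanSpace ℝ (Fin 2)) 1) (fun z => ‖z‖⁻¹) (ξ - η) with hk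
  have hk0 : ∀ η, 0 ≤ k η := fun η => indicator_inv_norm_nonneg _
  have hki : Integrable k := integrable_indicator_inv_norm.comp_sub_left ξ
  have hkI : ∫ η, k η = ∫ z, indicator (ball (0 : EuclideanSpace ℝ (Fin 2)) 1) (fun z => ‖z‖⁻¹) z :=
    integral_sub_left_eq_self (indicator (ball (0 : EuclideanSpace ℝ (Fin 2)) 1) fun z => ‖z‖⁻¹) volume ξ
  have hsm : AEStronglyMeasurable (fun η => Real.sqrt (k η)) volume :=
    Real.continuous_sqrt.comp_aestronglyMeasurable hki.aestronglyMeasurable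
  -- `f = √k`, `g = |w| √k`
  have hf : MemLp (fun η => Real.sqrt (k η)) (ENNReal.ofReal 2) volume := by
    rw [ENNReal.ofReal_ofNat, memLp_two_iff_integrable_sq hsm]
    simp_rw [Real.sq_sqrt (hk0 _)]
    exact hki
  have hg2 : (fun η => (|w η| * Real.sqrt (k η)) ^ 2) = fun η => w η ^ 2 * k η := by
    ext η
    rw [mul_pow, sq_abs, Real.sq_sqrt (hk0 η)]
  have hgm : AEStronglyMeasurable (fun η => |w η| * Real.sqrt (k η)) volume :=
    (continuous_abs.comp hw).aestronglyMeasurable.mul hsm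
  have hg : MemLp (fun η => |w η| * Real.sqrt (k η)) (ENNReal.ofReal 2) volume := by
    rw [ENNReal.ofReal_ofNat, memLp_two_iff_integrable_sq hgm, hg2]
    exact integrable_mul_indicator_inv_norm_of_continuous (hw.pow 2) ξ
  have hCS : ∫ η, Real.sqrt (k η) * (|w η| * Real.sqrt (k η)) ≤
      (∫ η, Real.sqrt (k η) ^ (2 : ℝ)) ^ (1 / (2 : ℝ)) *
        (∫ η, (|w η| * Real.sqrt (k η)) ^ (2 : ℝ)) ^ (1 / (2 : ℝ)) :=
    integral_mul_le_Lp_mul_Lq_of_nonneg Real.HolderConjugate.two_two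
      (Eventually.of_forall fun η => Real.sqrt_nonneg _)
      (Eventually.of_forall fun η => mul_nonneg (abs_nonneg _) (Real.sqrt_nonneg _)) hf hg
  have h1 : ∀ η, Real.sqrt (k η) * (|w η| * Real.sqrt (k η)) = |w η| * k η := fun η => by
    calc Real.sqrt (k η) * (|w η| * Real.sqrt (k η)) = |w η| * (Real.sqrt (k η) * Real.sqrt (k η)) := by ring
      _ = |w η| * k η := by rw [Real.mul_self_sqrt (hk0 η)]
  have h2 : ∀ η, Real.sqrt (k η) ^ (2 : ℝ) = k η := fun η => by
    rw [Real.rpow_two, Real.sq_sqrt (hk0 η)]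
  have h3 : ∀ η, (|w η| * Real.sqrt (k η)) ^ (2 : ℝ) = w η ^ 2 * k η := fun η => by
    rw [Real.rpow_two, mul_pow, sq_abs, Real.sq_sqrt (hk0 η)]
  simp_rw [h1, h2, h3, ← Real.sqrt_eq_rpow] at hCS
  have hA0 : 0 ≤ ∫ η, |w η| * k η := integral_nonneg fun η => mul_nonneg (abs_nonneg _) (hk0 η)
  have hP0 : 0 ≤ ∫ η, k η := integral_nonneg hk0
  have hQ0 : 0 ≤ ∫ η, w η ^ 2 * k η := integral_nonneg fun η => mul_nonneg (sq_nonneg _) (hk0 η)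
  calc (∫ η, |w η| * k η) ^ 2 ≤ (Real.sqrt (∫ η, k η) * Real.sqrt (∫ η, w η ^ 2 * k η)) ^ 2 :=
        pow_le_pow_left₀ hA0 hCS 2
    _ = (∫ η, k η) * ∫ η, w η ^ 2 * k η := by
        rw [mul_pow, Real.sq_sqrt hP0, Real.sq_sqrt hQ0]
    _ = (∫ z, indicator (ball (0 : EuclideanSpace ℝ (Fin 2)) 1) (fun z => ‖z‖⁻¹) z) *
          ∫ η, w η ^ 2 * k η := by rw [hkI]

/-- **Pointwise `L¹ + L^∞` bound on the Biot–Savart velocity** of a continuous integrable vorticity: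
`‖(K ∗ w)(ξ)‖ ≤ (2π)⁻¹ (∫ |w(η)| 𝟙_{|ξ−η|<1}|ξ−η|⁻¹ dη + ‖w‖₁)`. [folklore] -/
theorem norm_biotSavart2D_le_integral_abs_mul_indicator_add {w : EuclideanSpace ℝ (Fin 2) → ℝ}
    (hw : Continuous w) (hwi : Integrable w) (ξ : EuclideanSpace ℝ (Fin 2)) :
    ‖biotSavart2D w ξ‖ ≤ (2 * Real.pi)⁻¹ *
      ((∫ η, |w η| * indicator (ball (0 : EuclideanSpace ℝ (Fin 2)) 1) (fun z => ‖z‖⁻¹) (ξ - η)) +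
        ∫ η, |w η|) := by
  unfold biotSavart2D
  have h1 : Integrable fun η => |w η| * indicator (ball (0 : EuclideanSpace ℝ (Fin 2)) 1) (fun z => ‖z‖⁻¹) (ξ - η) :=
    integrable_mul_indicator_inv_norm_of_continuous (continuous_abs.comp hw) ξ
  have hint : Integrable fun η => (2 * Real.pi)⁻¹ *
      (|w η| * indicator (ball (0 : EuclideanSpace ℝ (Fin 2)) 1) (fun z => ‖z‖⁻¹) (ξ - η) + |w η|) :=
    (h1.add hwi.abs).const_mul _
  refine (norm_integral_le_of_norm_le hint (Eventually.of_forall fun η => ?_)).trans (le_of_eq ?_)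
  · rw [norm_smul, Real.norm_eq_abs]
    calc |w η| * ‖biotSavartKernel2D (ξ - η)‖
        ≤ |w η| * ((2 * Real.pi)⁻¹ *
            (indicator (ball (0 : EuclideanSpace ℝ (Fin 2)) 1) (fun z => ‖z‖⁻¹) (ξ - η) + 1)) :=
          mul_le_mul_of_nonneg_left (norm_biotSavartKernel2D_le_indicator_add_one _) (abs_nonneg _)
      _ = (2 * Real.pi)⁻¹ *
            (|w η| * indicator (ball (0 : EuclideanSpace ℝ (Fin 2)) 1) (fun z => ‖z‖⁻¹) (ξ - η) + |w η|) := by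
          ring
  · rw [integral_const_mul, integral_add h1 hwi.abs]

/-- **Squared pointwise bound**: with `k₁ = 𝟙_{|z|<1}|z|⁻¹`, `I₁ = ∫ k₁`,
`‖(K ∗ w)(ξ)‖² ≤ 2 (2π)⁻² (I₁ ∫ w(η)² k₁(ξ−η) dη + ‖w‖₁²)` (Cauchy–Schwarz in the near field). [folklore] -/
theorem norm_biotSavart2D_sq_le {w : EuclideanSpace ℝ (Fin 2) → ℝ} (hw : Continuous w) (hwi : Integrable w)
    (ξ : EuclideanSpace ℝ (Fin 2)) :
    ‖biotSavart2D w ξ‖ ^ 2 ≤ 2 * (2 * Real.pi)⁻¹ ^ 2 *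
      ((∫ z, indicator (ball (0 : EuclideanSpace ℝ (Fin 2)) 1) (fun z => ‖z‖⁻¹) z) *
          (∫ η, w η ^ 2 * indicator (ball (0 : EuclideanSpace ℝ (Fin 2)) 1) (fun z => ‖z‖⁻¹) (ξ - η)) +
        (∫ η, |w η|) ^ 2) := by
  have h := norm_biotSavart2D_le_integral_abs_mul_indicator_add hw hwi ξ
  have hCS := sq_integral_abs_mul_indicator_inv_norm_le hw ξ
  set a : ℝ := ∫ η, |w η| * indicator (ball (0 : EuclideanSpace ℝ (Fin 2)) 1) (fun z => ‖z‖⁻¹) (ξ - η) with ha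
  set n : ℝ := ∫ η, |w η| with hn
  have ha0 : 0 ≤ a := integral_nonneg fun η => mul_nonneg (abs_nonneg _) (indicator_inv_norm_nonneg _)
  have hn0 : 0 ≤ n := integral_nonneg fun η => abs_nonneg _
  calc ‖biotSavart2D w ξ‖ ^ 2 ≤ ((2 * Real.pi)⁻¹ * (a + n)) ^ 2 := pow_le_pow_left₀ (norm_nonneg _) h 2
    _ ≤ (2 * Real.pi)⁻¹ ^ 2 * (2 * (a ^ 2 + n ^ 2)) := by
        rw [mul_pow]
        refine mul_le_mul_of_nonneg_left ?_ (by positivity)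
        nlinarith [sq_nonneg (a - n)]
    _ ≤ (2 * Real.pi)⁻¹ ^ 2 * (2 * ((∫ z, indicator (ball (0 : EuclideanSpace ℝ (Fin 2)) 1) (fun z => ‖z‖⁻¹) z) *
          (∫ η, w η ^ 2 * indicator (ball (0 : EuclideanSpace ℝ (Fin 2)) 1) (fun z => ‖z‖⁻¹) (ξ - η)) + n ^ 2)) := by
        gcongr
    _ = _ := by ring

/-- W3-C (Young-type bound, split kernel `K = K𝟙_{|z|<1} + K𝟙_{|z|≥1} ∈ L¹ + L^∞`):
`∫ ‖K∗w‖² h² ≤ C (H² ∫ w² + (∫|w|)² ∫ h²)` for `|h| ≤ H`, `h ∈ L²`, `w ∈ C⁰ ∩ L¹ ∩ L²`. -/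
theorem biotSavart2D_mul_sq_integral_le :
    ∃ C : ℝ, 0 < C ∧ ∀ (w h : EuclideanSpace ℝ (Fin 2) → ℝ) (H : ℝ), Continuous w → Integrable w →
      Integrable (fun η => w η ^ 2) → AEStronglyMeasurable h volume → (∀ ξ, |h ξ| ≤ H) →
      Integrable (fun ξ => h ξ ^ 2) →
      Integrable (fun ξ => ‖biotSavart2D w ξ‖ ^ 2 * h ξ ^ 2) ∧
        ∫ ξ, ‖biotSavart2D w ξ‖ ^ 2 * h ξ ^ 2 ≤
          C * (H ^ 2 * (∫ η, w η ^ 2) + (∫ η, |w η|) ^ 2 * ∫ ξ, h ξ ^ 2) := by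
  -- the absolute constant `I₁ = ∫ 𝟙_{|z|<1}|z|⁻¹`
  set I₁ : ℝ := ∫ z, indicator (ball (0 : EuclideanSpace ℝ (Fin 2)) 1) (fun z => ‖z‖⁻¹) z with hI₁
  have hI₁0 : 0 ≤ I₁ := integral_nonneg indicator_inv_norm_nonneg
  refine ⟨2 * (2 * Real.pi)⁻¹ ^ 2 * (I₁ ^ 2 + 1), by positivity, ?_⟩
  intro w h H hw hwi hw2 hh hhH hh2
  set n : ℝ := ∫ η, |w η| with hn
  -- `b = w² ∗ k₁`
  set b : EuclideanSpace ℝ (Fin 2) → ℝ :=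
    fun ξ => ∫ η, w η ^ 2 * indicator (ball (0 : EuclideanSpace ℝ (Fin 2)) 1) (fun z => ‖z‖⁻¹) (ξ - η) with hb
  have hb_eq : b = MeasureTheory.convolution (fun η => w η ^ 2)
      (indicator (ball (0 : EuclideanSpace ℝ (Fin 2)) 1) (fun z => ‖z‖⁻¹)) (ContinuousLinearMap.mul ℝ ℝ) volume := by
    ext ξ
    rw [convolution_mul]
  have hbi : Integrable b := by
    rw [hb_eq]
    exact hw2.integrable_convolution _ integrable_indicator_inv_norm
  have hb_int : ∫ ξ, b ξ = (∫ η, w η ^ 2) * I₁ := by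
    rw [hb_eq, integral_convolution _ hw2 integrable_indicator_inv_norm, ContinuousLinearMap.mul_apply']
  have hb0 : ∀ ξ, 0 ≤ b ξ := fun ξ =>
    integral_nonneg fun η => mul_nonneg (sq_nonneg _) (indicator_inv_norm_nonneg _)
  have hH2 : ∀ ξ, h ξ ^ 2 ≤ H ^ 2 := fun ξ => by
    rw [← sq_abs (h ξ)]
    exact pow_le_pow_left₀ (abs_nonneg _) (hhH ξ) 2
  -- the integrable majorant
  set F : EuclideanSpace ℝ (Fin 2) → ℝ :=
    fun ξ => 2 * (2 * Real.pi)⁻¹ ^ 2 * (I₁ * H ^ 2 * b ξ + n ^ 2 * h ξ ^ 2) with hF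
  have hFi : Integrable F := ((hbi.const_mul _).add (hh2.const_mul _)).const_mul _
  have hpt : ∀ ξ, ‖biotSavart2D w ξ‖ ^ 2 * h ξ ^ 2 ≤ F ξ := fun ξ => by
    have h5 := norm_biotSavart2D_sq_le hw hwi ξ
    calc ‖biotSavart2D w ξ‖ ^ 2 * h ξ ^ 2
        ≤ 2 * (2 * Real.pi)⁻¹ ^ 2 * (I₁ * b ξ + n ^ 2) * h ξ ^ 2 :=
          mul_le_mul_of_nonneg_right h5 (sq_nonneg _)
      _ = 2 * (2 * Real.pi)⁻¹ ^ 2 * (I₁ * b ξ * h ξ ^ 2 + n ^ 2 * h ξ ^ 2) := by ring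
      _ ≤ 2 * (2 * Real.pi)⁻¹ ^ 2 * (I₁ * b ξ * H ^ 2 + n ^ 2 * h ξ ^ 2) := by
          have h6 : I₁ * b ξ * h ξ ^ 2 ≤ I₁ * b ξ * H ^ 2 :=
            mul_le_mul_of_nonneg_left (hH2 ξ) (mul_nonneg hI₁0 (hb0 ξ))
          have h7 : I₁ * b ξ * h ξ ^ 2 + n ^ 2 * h ξ ^ 2 ≤ I₁ * b ξ * H ^ 2 + n ^ 2 * h ξ ^ 2 := by linarith
          exact mul_le_mul_of_nonneg_left h7 (by positivity)
      _ = F ξ := by simp only [hF]; ring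
  have hmeas : AEStronglyMeasurable (fun ξ => ‖biotSavart2D w ξ‖ ^ 2 * h ξ ^ 2) volume :=
    (((stronglyMeasurable_biotSavart2D hw.measurable).aestronglyMeasurable.norm).pow 2).mul (hh.pow 2)
  have hInt : Integrable (fun ξ => ‖biotSavart2D w ξ‖ ^ 2 * h ξ ^ 2) :=
    hFi.mono' hmeas (Eventually.of_forall fun ξ => by
      rw [Real.norm_of_nonneg (by positivity)]
      exact hpt ξ)
  refine ⟨hInt, ?_⟩
  have hw20 : 0 ≤ ∫ η, w η ^ 2 := integral_nonneg fun _ => sq_nonneg _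
  have hh20 : 0 ≤ ∫ ξ, h ξ ^ 2 := integral_nonneg fun _ => sq_nonneg _
  have hkey : I₁ * H ^ 2 * ((∫ η, w η ^ 2) * I₁) + n ^ 2 * ∫ ξ, h ξ ^ 2 ≤
      (I₁ ^ 2 + 1) * (H ^ 2 * (∫ η, w η ^ 2) + n ^ 2 * ∫ ξ, h ξ ^ 2) := by
    nlinarith [mul_nonneg (mul_nonneg (sq_nonneg I₁) (sq_nonneg n)) hh20, mul_nonneg (sq_nonneg H) hw20]
  calc ∫ ξ, ‖biotSavart2D w ξ‖ ^ 2 * h ξ ^ 2 ≤ ∫ ξ, F ξ := integral_mono hInt hFi hpt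
    _ = 2 * (2 * Real.pi)⁻¹ ^ 2 * (I₁ * H ^ 2 * ((∫ η, w η ^ 2) * I₁) + n ^ 2 * ∫ ξ, h ξ ^ 2) := by
        simp only [hF]
        rw [integral_const_mul, integral_add (hbi.const_mul _) (hh2.const_mul _), integral_const_mul,
          integral_const_mul, hb_int]
    _ ≤ 2 * (2 * Real.pi)⁻¹ ^ 2 * ((I₁ ^ 2 + 1) * (H ^ 2 * (∫ η, w η ^ 2) + n ^ 2 * ∫ ξ, h ξ ^ 2)) :=
        mul_le_mul_of_nonneg_left hkey (by positivity)
    _ = 2 * (2 * Real.pi)⁻¹ ^ 2 * (I₁ ^ 2 + 1) * (H ^ 2 * (∫ η, w η ^ 2) + n ^ 2 * ∫ ξ, h ξ ^ 2) := by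
        ring

end Summit.AnomalousDissipation.AnomalousDissipation.Theorems.MarginalStabilityChainStretchedVortexRows

end
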